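import Mathlib
import Literature.Computability.Complexity.CNF
import Literature.Computability.MetaComplexity.Frege
import Literature.Computability.MetaComplexity.FpLinearSystems
import Literature.Computability.MetaComplexity.ScopeExpansion
import Literature.Computability.MetaComplexity.ExpanderTreewidth
import Literature.Combinatorics.SimpleGraph.TreeDecomposition
import HarnessLib

/-!
# TseitinDepthFrege

Topic `Literature/Computability/MetaComplexity`. Named literature fact(s) relocated by the gate from `Summits/PneNP/PneNP/Theorems/ExpanderLinearGeneratorsExpansionForcesDepthFregeSizeTseitin.lean`
(accept-time relocation of `[cite]`d propositions written inline in a Summits proposal; human ruling 2026-08-15).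
Sources: GalesiEtAl2023.

* `Literature.Computability.MetaComplexity.galesiEtAl_tseitin_treewidth_depthFrege_lowerBound`
-/

namespace Literature.Computability.MetaComplexity

open Finset Literature.Computability.MetaComplexity Literature.Computability.Complexity

/-- **Galesi–Itsykson–Riazanov–Sofronova, treewidth lower bound for bounded-depth Frege proofs of
Tseitin formulas** (MFCS 2019, Theorem 1, lower-bound half; proved as Theorem 17 from Håstad's grid
theorem and Chuzhoy's polynomial excluded-grid theorem): "There is a constant `K` such that for any
graph `G` over `n` nodes and for all `d ≤ K log n / log log n`, every depth-`d` Frege proof of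
`¬T(G, f)` has size at least `2^{tw(G)^{Ω(1/d)}}`" (Theorem 17: for every CONNECTED graph `G`,
parallel edges allowed, §2.3). Rendered in the tree's vocabulary: the Tseitin formula of a charged
multigraph is the sum-encoding `sumEncoding 1 E` (one canonical parity CNF per vertex, B = 1) of a
system `E` over `𝔽₂` in which every variable occurs in exactly two rows (an edge) or in none —
rows `i` = vertices with charge `(E i).2`, `G` = the row graph (rows adjacent iff their supports
meet), whose treewidth is `tw(G)`; proofs are `textbookFrege` proofs of alternation depth `≤ d`
measured by `proofSize`. The absolute exponent `c` (`Ω(1/d) = c/d`) and the threshold `t₀(d)` on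
the treewidth absorb the `O(1)` depth shift and polynomial size change between Frege formalisms
(Lemma 3 of the source; the source counts depth as alternations `+ 1`), the bracketing of `⋀/⋁`,
and the side condition `d ≤ K log |V| / log log |V|` (the number of vertices is `m ≥ tw(G) + 1 ≥
t₀(d) + 1`). Unsatisfiability is implicit (a proof of `¬T` exists only for unsatisfiable `T`,
`isSound_textbookFrege`); variables occurring in no row do not occur in the formula.
[cite: GalesiEtAl2023, Theorem 1 (lower bound) and Theorem 17]
[file Computability/MetaComplexity/TseitinDepthFrege] -/
def galesiEtAl_tseitin_treewidth_depthFrege_lowerBound : Prop :=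
  ∃ c : ℝ, 0 < c ∧ ∀ d : ℕ, ∃ t₀ : ℕ, ∀ (n m : ℕ)
    (E : Fin m → Literature.Computability.MetaComplexity.LinEqMod 2 n) (G : SimpleGraph (Fin m)),
    (∀ j : Fin n, (Finset.univ.filter fun i => j ∈ (E i).supp).card = 2 ∨
      (Finset.univ.filter fun i => j ∈ (E i).supp).card = 0) →
    (∀ i i' : Fin m, G.Adj i i' ↔ i ≠ i' ∧ ((E i).supp ∩ (E i').supp).Nonempty) →
    G.Connected → t₀ ≤ Literature.Combinatorics.SimpleGraph.treewidth G →
    ∀ π : List (Literature.Computability.Complexity.PropForm ℕ),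
      Literature.Computability.MetaComplexity.textbookFrege.IsDepthProofOf d π
        (Literature.Computability.Complexity.PropForm.neg
          (Literature.Computability.Complexity.PropForm.ofCNF
            (Literature.Computability.MetaComplexity.sumEncoding 1 E))) →
        (2 : ℝ) ^ ((Literature.Combinatorics.SimpleGraph.treewidth G : ℝ) ^ (c / d)) ≤
          (Literature.Computability.MetaComplexity.proofSize π : ℝ)

end Literature.Computability.MetaComplexity
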